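import Literature.Computability.AlgebraicComplexity.Kron444HullCheck
import HarnessLib

/-!
# `Kron(4,4,4) ⊆ conv(328 vertices)`: certificate checks, part 9/14

Proofs file (computations only): the node checks of `Kron444HullCheck.lean` for the chunks
115 … 128 of the certificate, each decided by the kernel (`decide +kernel`; `maxHeartbeats 0`:
a chunk is ≈ 10⁵–10⁶ kernel reductions). Assembled in `Kron444Hull.lean`. [folklore]
-/

set_option Elab.async false

namespace Literature.Computability.AlgebraicComplexity.Kron444Hull

/-- Nodes `2875 … 2899` of the certificate (chunk `115`) pass `checkNodeRec`. [folklore] -/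
theorem checkChunk_115 : checkChunk 115 25 = true := by
  set_option maxHeartbeats 0 in decide +kernel

/-- Nodes `2900 … 2924` of the certificate (chunk `116`) pass `checkNodeRec`. [folklore] -/
theorem checkChunk_116 : checkChunk 116 25 = true := by
  set_option maxHeartbeats 0 in decide +kernel

/-- Nodes `2925 … 2949` of the certificate (chunk `117`) pass `checkNodeRec`. [folklore] -/
theorem checkChunk_117 : checkChunk 117 25 = true := by
  set_option maxHeartbeats 0 in decide +kernel

/-- Nodes `2950 … 2974` of the certificate (chunk `118`) pass `checkNodeRec`. [folklore] -/
theorem checkChunk_118 : checkChunk 118 25 = true := by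
  set_option maxHeartbeats 0 in decide +kernel

/-- Nodes `2975 … 2999` of the certificate (chunk `119`) pass `checkNodeRec`. [folklore] -/
theorem checkChunk_119 : checkChunk 119 25 = true := by
  set_option maxHeartbeats 0 in decide +kernel

/-- Nodes `3000 … 3024` of the certificate (chunk `120`) pass `checkNodeRec`. [folklore] -/
theorem checkChunk_120 : checkChunk 120 25 = true := by
  set_option maxHeartbeats 0 in decide +kernel

/-- Nodes `3025 … 3049` of the certificate (chunk `121`) pass `checkNodeRec`. [folklore] -/
theorem checkChunk_121 : checkChunk 121 25 = true := by
  set_option maxHeartbeats 0 in decide +kernel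

/-- Nodes `3050 … 3074` of the certificate (chunk `122`) pass `checkNodeRec`. [folklore] -/
theorem checkChunk_122 : checkChunk 122 25 = true := by
  set_option maxHeartbeats 0 in decide +kernel

/-- Nodes `3075 … 3099` of the certificate (chunk `123`) pass `checkNodeRec`. [folklore] -/
theorem checkChunk_123 : checkChunk 123 25 = true := by
  set_option maxHeartbeats 0 in decide +kernel

/-- Nodes `3100 … 3124` of the certificate (chunk `124`) pass `checkNodeRec`. [folklore] -/
theorem checkChunk_124 : checkChunk 124 25 = true := by
  set_option maxHeartbeats 0 in decide +kernel

/-- Nodes `3125 … 3149` of the certificate (chunk `125`) pass `checkNodeRec`. [folklore] -/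
theorem checkChunk_125 : checkChunk 125 25 = true := by
  set_option maxHeartbeats 0 in decide +kernel

/-- Nodes `3150 … 3174` of the certificate (chunk `126`) pass `checkNodeRec`. [folklore] -/
theorem checkChunk_126 : checkChunk 126 25 = true := by
  set_option maxHeartbeats 0 in decide +kernel

/-- Nodes `3175 … 3199` of the certificate (chunk `127`) pass `checkNodeRec`. [folklore] -/
theorem checkChunk_127 : checkChunk 127 25 = true := by
  set_option maxHeartbeats 0 in decide +kernel

/-- Nodes `3200 … 3224` of the certificate (chunk `128`) pass `checkNodeRec`. [folklore] -/
theorem checkChunk_128 : checkChunk 128 25 = true := by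
  set_option maxHeartbeats 0 in decide +kernel

end Literature.Computability.AlgebraicComplexity.Kron444Hull
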